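import Literature.IUT.HodgeArakelov.MonoThetaProjectiveBridgeEtThTower
import Literature.IUT.HodgeArakelov.MonoThetaProjectiveNaturalSystem
import Literature.IUT.HodgeArakelov.MonoThetaProjectiveModelSystem
import Literature.IUT.HodgeArakelov.IotaInvariantThetaInftyOrbitFinite
import Literature.IUT.HodgeArakelov.BadPlaceSettingOfDoubleUnderlineCor218i
import Literature.IUT.HodgeArakelov.ThetaEvaluationSettingModelProofs
import Literature.AnabelianGeometry.EtaleTheta.Discharge.Sec1CompatHolds

/-!
# [IUTchII] §1–2 cone closers (Prop. 1.5, 2.1, 2.2) with the PROVED [EtTh] input `Compat` supplied by name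

abc-iut cell, sub-cell L-K/R-C (D-0079), seat abc-iut-L6-t5 gen 12, row «K-READY-L6» — file 2 of 2 (file 1:
`EtThProvedInputsSupplied.lean`). Source of the row: the L6 lines of abc-iut-c312-2 gen 5's `CONE-K-READY.tsv`
(K-census v4, 2026-08-26T15:06Z) = binder sites in cone CLOSING theorems whose FACT-LIST row is already PROVED in the
tree. This file covers the 11 remaining sites of **F-2491** `ThetaSetting.Compat` ([EtTh] §1 p.22: the containments
`Δ_Θ ⊆ (Δ^tp_Y)^Θ`, `Δ_Θ ⊆ (Δ^tp_Ÿ)^Θ` and `K̈/K` Galois; witness `ThetaSetting.compat`, `Discharge/Sec1CompatHolds.lean`,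
abc-iut-L2 lineage w5-d017 — a theorem for EVERY `D : ThetaSetting p`), binder `hC`, in the closers of

* `IUTchII:Prop1.5(i)` — `EtaleLevels.prop15_i'_etaleLevels`, `prop15_i'_of_lift_of_finite`
  (`MonoThetaProjectiveBridgeEtThProofs.lean`), `prop15_i'_of_cyclotomeTower` (`…Tower.lean`);
* `IUTchII:Prop1.5(ii)` — `EtaleLevels.naturalSystem_PiX`, `naturalSystem_transX` (`MonoThetaProjectiveNaturalSystem.lean`),
  `transitionsAreIsos_modelSystem` (`MonoThetaProjectiveModelSystem.lean`);
* `IUTchII:Prop1.5(iii)` — `EtaleThetaDataOfSetting.conj_etaDd_eq_mul_pow`, `conj_rootLift_div_mem_range_pow`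
  (`IotaInvariantThetaInftyOrbitFinite.lean`);
* `IUTchII:Prop2.1` — `TemperedCoverings.YL_eq_of_cor218_i` (`BadPlaceSettingOfDoubleUnderlineCor218i.lean`),
  `TemperedCoverings.YL_eq_of_piYddCharacteristic` (`BadPlaceSettingOfDoubleUnderline.lean`);
* `IUTchII:Prop2.2(i)` — `prop22_i'_etaleThetaDataOfSetting` (`ThetaEvaluationSettingModelProofs.lean`).

WHAT THIS FILE IS. PROOF-ONLY (no `def`, no Prop-valued fact, no `instance`, no `sorry`): for each site ONE sibling
`<closer>_compatSupplied` whose statement is the closer's SOURCE statement with the binder `hC : D.Compat` deleted and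
each of its occurrences (in later binder types — including the `haveI := hC.GtpYdd_normal` instance lets — and in the
conclusion) replaced by the witness `D.compat`; proof = the closer applied to `D.compat`. Same `variable` telescopes
as the source sections. The closers (lineages abc-iut-L6-t1, w4-d010, w4-d013, w4-d024, w4-d030, w4-d034, w4-d038,
L6-t19) are untouched; nothing printed is restated as a new statement.

WHAT IT MOVES AND WHAT IT DOES NOT (honest): the «proved» binder-pair class of the K census (with file 1: 23 of its 32
sites); the nodes are already NODES-discharged; `proved` rows are not assumption-class, so K1/K3, `cone_discharged`
and the C scoreboard are unchanged; re-pointing the kernel index to a sibling is abc-iut-c312-2's decision. Typed ≠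
proved-as-printed; instantiated ≠ endorsed; no side taken on [IUTchIII] Cor. 3.12; nothing here asserts that abc is
proved or refuted. [claim: Mochizuki2012, status: disputed] (statements); [cite: MochizukiEtTh2009, Prop 1.5 p.22]
(the supplied input).
-/

namespace Literature.IUT.HodgeArakelov

/-! ## [IUTchII] Prop. 1.5 (i)′/(ii) for the genuine model family over `ℕ_{≥1}` -/

namespace EtaleLevels

open Literature.AnabelianGeometry.EtaleTheta Literature.AnabelianGeometry.SemiGraphs
open scoped Literature.AnabelianGeometry.EtaleTheta

variable {p : ℕ} [Fact p.Prime] {D : Literature.AnabelianGeometry.EtaleTheta.ThetaSetting p}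
  {E : D.EtaleThetaData} {l : ℕ} (C : E.DoubleUnderline l) (hS : D.Sec2Hyps)
  (hl : l.Prime) (hp2 : p ≠ 2) (hpl : p ≠ l) (hζ : ∃ ζ : D.K, IsPrimitiveRoot ζ (4 * l))
  (mods : ∀ M : ℕ+, D.CyclotomeMod l M)
  (f : contCocycles D.toTheta D.DeltaTheta C.GtpYdduu) (hf : f ∈ C.rootCocycles D.compat)
  (hmods : ∀ (M M' : ℕ+) (h : (M : ℕ) ∣ (M' : ℕ)) (x : D.lDeltaTheta l),
    MuN.red p M M' h ((mods M').red x) = (mods M).red x)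

/-- K-move, node `IUTchII:Prop1.5(i)`, site `prop15_i'_of_lift_of_finite`/`hC` (F-2491 supplied by
`ThetaSetting.compat`): Prop. 1.5 (i)′ for the genuine model family of `X̲̲_K`, modulo `hlift`/`hfin` (the two
clauses of [EtTh] Cor. 2.18 (iv) at the models), temp-slimness and `haugOpen` — the [EtTh] §1 containments no longer
a binder. [claim: Mochizuki2012, status: disputed] (IUTchII §1 Prop 1.5 (i), kurims p.29) -/
theorem prop15_i'_of_lift_of_finite_compatSupplied
    (hslimX : Literature.AlgebraicGeometry.Frobenioids.IsSlimGroup D.PiTemp) (haugOpen : IsOpenMap D.aug)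
    (hlift : ∀ (M : ℕ+) (φ : MonoThetaEnv.Iso ((modelFamily C D.compat hS hl hp2 hpl hζ mods f hf).modelEnv 1)
        ((modelFamily C D.compat hS hl hp2 hpl hζ mods f hf).modelEnv 1)),
      ∃ ψ : MonoThetaEnv.Iso ((modelFamily C D.compat hS hl hp2 hpl hζ mods f hf).modelEnv M)
          ((modelFamily C D.compat hS hl hp2 hpl hζ mods f hf).modelEnv M),
        ∀ x, (reductions C D.compat hS hl hp2 hpl hζ mods f hf hmods hslimX).red (PNat.dvd_iff.mp (one_dvd M))
            (ψ.iso x) =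
          φ.iso ((reductions C D.compat hS hl hp2 hpl hζ mods f hf hmods hslimX).red
            (PNat.dvd_iff.mp (one_dvd M)) x))
    (hfin : ∀ M : ℕ+, Set.Finite
      {φ : MonoThetaEnv.Iso ((modelFamily C D.compat hS hl hp2 hpl hζ mods f hf).modelEnv M)
          ((modelFamily C D.compat hS hl hp2 hpl hζ mods f hf).modelEnv M) |
        ∀ x, (reductions C D.compat hS hl hp2 hpl hζ mods f hf hmods hslimX).red (PNat.dvd_iff.mp (one_dvd M))
            (φ.iso x) =
          (reductions C D.compat hS hl hp2 hpl hζ mods f hf hmods hslimX).red (PNat.dvd_iff.mp (one_dvd M)) x})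
    (A B : MonoThetaProjSystem (modelFamily C D.compat hS hl hp2 hpl hζ mods f hf)) :
    Literature.IUT.HodgeArakelov.Prop15_i' (reductions C D.compat hS hl hp2 hpl hζ mods f hf hmods hslimX) A B :=
  prop15_i'_of_lift_of_finite C D.compat hS hl hp2 hpl hζ mods f hf hmods hslimX haugOpen hlift hfin A B

/-- K-move, node `IUTchII:Prop1.5(i)`, site `prop15_i'_etaleLevels`/`hC` (F-2491 supplied): Prop. 1.5 (i)′ for the
genuine model family of `X̲̲_K` over `ℕ_{≥1}`, modulo exactly L2's level facts `Cor218_iv_surjective`,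
`Cor218_iv_fibre`, temp-slimness and `haugOpen` — the [EtTh] §1 containments no longer a binder.
[claim: Mochizuki2012, status: disputed] (IUTchII §1 Prop 1.5 (i), kurims p.29) -/
theorem prop15_i'_etaleLevels_compatSupplied
    (hslimX : Literature.AlgebraicGeometry.Frobenioids.IsSlimGroup D.PiTemp) (haugOpen : IsOpenMap D.aug)
    (hsurj : ∀ M : ℕ+, (levelData C D.compat hS mods M).Cor218_iv_surjective)
    (hfibre : ∀ M : ℕ+, (levelData C D.compat hS mods M).Cor218_iv_fibre)
    (A B : MonoThetaProjSystem (modelFamily C D.compat hS hl hp2 hpl hζ mods f hf)) :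
    Literature.IUT.HodgeArakelov.Prop15_i' (reductions C D.compat hS hl hp2 hpl hζ mods f hf hmods hslimX) A B :=
  prop15_i'_etaleLevels C D.compat hS hl hp2 hpl hζ mods f hf hmods hslimX haugOpen hsurj hfibre A B

variable (h15 : Literature.AnabelianGeometry.EtaleTheta.ThetaSetting.Prop15iii E D.compat) (L : C.CuspLabels)
  (hZ : ∀ M : ℕ+, Nonempty (ModelCyclotomes.lDeltaQuot (C.rigidData (mods M) D.compat hS h15 L) ≃*
    Literature.IUT.HodgeTheaters.ZHat))

/-- K-move, node `IUTchII:Prop1.5(ii)`, site `naturalSystem_PiX`/`hC` (F-2491 supplied): `Π_X(M^Θ_*) = Π^tp_{X̲̲}`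
for the natural system (bookkeeping `rfl` of the closer, the [EtTh] §1 containments no longer a binder).
[claim: Mochizuki2012, status: disputed] (IUTchII §1 Prop 1.5 (ii), kurims p.29) -/
theorem naturalSystem_PiX_compatSupplied :
    (naturalSystem C D.compat hS hl hp2 hpl hζ mods f hf hmods h15 L hZ).PiX = TopGroup.of ↥C.Huu :=
  naturalSystem_PiX C D.compat hS hl hp2 hpl hζ mods f hf hmods h15 L hZ

/-- K-move, node `IUTchII:Prop1.5(ii)`, site `naturalSystem_transX`/`hC` (F-2491 supplied): the transitions of the
natural system on `Π_X` are identities (bookkeeping, the [EtTh] §1 containments no longer a binder).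
[claim: Mochizuki2012, status: disputed] (IUTchII §1 Prop 1.5 (ii), kurims p.29) -/
theorem naturalSystem_transX_compatSupplied {M M' : ℕ+} (h : (M : ℕ) ∣ (M' : ℕ)) (x : ↥C.Huu) :
    (naturalSystem C D.compat hS hl hp2 hpl hζ mods f hf hmods h15 L hZ).transX h x = x :=
  naturalSystem_transX C D.compat hS hl hp2 hpl hζ mods f hf hmods h15 L hZ h x

/-- K-move, node `IUTchII:Prop1.5(ii)`, site `transitionsAreIsos_modelSystem`/`hC` (F-2491 supplied): the transition
morphisms of `Π_X(M^Θ_*)` for the model system are isomorphisms and topological isomorphisms lift to morphisms of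
mono-theta environments, given `hchar` and the level fact `Cor218_iv_surjective` — the [EtTh] §1 containments no
longer a binder. [claim: Mochizuki2012, status: disputed] (IUTchII §1 Prop 1.5 (ii), kurims p.29) -/
theorem transitionsAreIsos_modelSystem_compatSupplied
    (hchar : Literature.AnabelianGeometry.EtaleTheta.IsTopCharacteristic ↥C.Huu (D.GtpY.subgroupOf C.Huu))
    (hsurj : ∀ M : ℕ+, (levelData C D.compat hS mods M).Cor218_iv_surjective) :
    (modelSystem C D.compat hS hl hp2 hpl hζ mods f hf hmods h15 L hZ).transitionsAreIsos :=
  transitionsAreIsos_modelSystem C D.compat hS hl hp2 hpl hζ mods f hf hmods h15 L hZ hchar hsurj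

end EtaleLevels

namespace EtaleLevels

open Literature.AnabelianGeometry.EtaleTheta Literature.AnabelianGeometry.SemiGraphs
open scoped Literature.AnabelianGeometry.EtaleTheta

variable {p : ℕ} [Fact p.Prime] {D : Literature.AnabelianGeometry.EtaleTheta.ThetaSetting p}
  {E : D.EtaleThetaData} {l : ℕ} (C : E.DoubleUnderline l) (hS : D.Sec2Hyps)
  (hl : l.Prime) (hp2 : p ≠ 2) (hpl : p ≠ l) (hζ : ∃ ζ : D.K, IsPrimitiveRoot ζ (4 * l))
  {Es : Set ℕ+} (τ : D.CyclotomeTower l Es)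
  (f : contCocycles D.toTheta D.DeltaTheta C.GtpYdduu) (hf : f ∈ C.rootCocycles D.compat)

/-- K-move, node `IUTchII:Prop1.5(i)`, site `prop15_i'_of_cyclotomeTower`/`hC` (F-2491 supplied): Prop. 1.5 (i)′
over `ℕ_{≥1}` from an [EtTh] §1 theta setting and a cyclotome tower over any cofinal chain, modulo temp-slimness,
`haugOpen` and the level facts `Cor218_iv_surjective`, `Cor218_iv_fibre` — the [EtTh] §1 containments no longer a
binder. [claim: Mochizuki2012, status: disputed] (IUTchII §1 Prop 1.5 (i), kurims p.29) -/
theorem prop15_i'_of_cyclotomeTower_compatSupplied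
    (hslimX : Literature.AlgebraicGeometry.Frobenioids.IsSlimGroup D.PiTemp) (haugOpen : IsOpenMap D.aug)
    (hsurj : ∀ M : ℕ+, (C.thetaEnvData (τ.modAll M) D.compat hS).Cor218_iv_surjective)
    (hfibre : ∀ M : ℕ+, (C.thetaEnvData (τ.modAll M) D.compat hS).Cor218_iv_fibre)
    (A B : MonoThetaProjSystem (modelFamily C D.compat hS hl hp2 hpl hζ τ.modAll f hf)) :
    Literature.IUT.HodgeArakelov.Prop15_i'
      (reductions C D.compat hS hl hp2 hpl hζ τ.modAll f hf τ.red_modAll hslimX) A B :=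
  prop15_i'_of_cyclotomeTower C D.compat hS hl hp2 hpl hζ τ f hf hslimX haugOpen hsurj hfibre A B

end EtaleLevels

/-! ## [IUTchII] Prop. 1.5 (iii): congruent parameters give an `M`-th power (the Π^tp_Ÿ-side algebra) -/

namespace EtaleThetaDataOfSetting

open Literature.AnabelianGeometry.EtaleTheta Literature.AnabelianGeometry.SemiGraphs
open scoped IsMulCommutative

variable {p : ℕ} [Fact p.Prime] {D : Literature.AnabelianGeometry.EtaleTheta.ThetaSetting p}
  {E : D.EtaleThetaData} {l : ℕ} (C : E.DoubleUnderline l)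

/-- K-move, node `IUTchII:Prop1.5(iii)`, site `conj_etaDd_eq_mul_pow`/`hC` (F-2491 supplied): two conjugates of the
lifted theta class with congruent parameters differ by an `M`-th power in `H¹(Π^tp_Ÿ, Δ_Θ)`; the normality instances
are now the THEOREMS `D.compat.GtpYddTheta_normal` / `D.compat.GtpYdd_normal`.
[claim: Mochizuki2012, status: disputed] (IUTchII §1 Prop 1.5 (iii), kurims p.29) [cite: MochizukiEtTh2009, Prop 1.5 (iii) p.23] -/
theorem conj_etaDd_eq_mul_pow_compatSupplied {x' : D.H1Theta (D.GtpYdd.map D.toTheta)}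
    (hx' : D.inflTheta D.GtpYdd x' = E.etaDd) {σ σ₀ : D.PiTemp} {uσ uσ₀ sU vU vU₀ : (↥D.Kdd)ˣ} {M : ℕ}
    {k : ℤ} (ha : Multiplicative.toAdd (D.toZ σ) = Multiplicative.toAdd (D.toZ σ₀) + M * k)
    (huσ : uσ = sU * vU ^ M) (huσ₀ : uσ₀ = sU * vU₀ ^ M)
    (hσ : haveI := D.compat.GtpYddTheta_normal
      ContH1.conj (MonoidHom.id D.GtpTheta) D.DeltaTheta (D.toTheta σ) x' =
        x' * (E.logUdd ^ (-(2 * Multiplicative.toAdd (D.toZ σ)))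
          * E.kumYdd (E.toKddHat D.qddUnit) ^ (-(Multiplicative.toAdd (D.toZ σ) * Multiplicative.toAdd (D.toZ σ)))
          * E.kumYdd (E.toKddHat uσ)))
    (hσ₀ : haveI := D.compat.GtpYddTheta_normal
      ContH1.conj (MonoidHom.id D.GtpTheta) D.DeltaTheta (D.toTheta σ₀) x' =
        x' * (E.logUdd ^ (-(2 * Multiplicative.toAdd (D.toZ σ₀)))
          * E.kumYdd (E.toKddHat D.qddUnit) ^ (-(Multiplicative.toAdd (D.toZ σ₀) * Multiplicative.toAdd (D.toZ σ₀)))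
          * E.kumYdd (E.toKddHat uσ₀))) :
    ∃ y : D.H1 D.GtpYdd,
      haveI := D.compat.GtpYdd_normal
      ContH1.conj D.toTheta D.DeltaTheta σ E.etaDd = ContH1.conj D.toTheta D.DeltaTheta σ₀ E.etaDd * y ^ M :=
  conj_etaDd_eq_mul_pow (E := E) D.compat hx' ha huσ huσ₀ hσ hσ₀

/-- K-move, node `IUTchII:Prop1.5(iii)`, site `conj_rootLift_div_mem_range_pow`/`hC` (F-2491 supplied): pointwise
comparison of two conjugates of the root cocycle on `Π^tp_Ÿ̲̲ ∩ chiKer(M)` up to `N`-th powers of `l·Δ_Θ`; the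
normality instances are now the THEOREMS `piYdd_normal C D.compat` / `D.compat.GtpYdd_normal`.
[claim: Mochizuki2012, status: disputed] (IUTchII §1 Prop 1.5 (iii), kurims p.29) [cite: MochizukiEtTh2009, Prop 1.5 (iii) p.23] -/
theorem conj_rootLift_div_mem_range_pow_compatSupplied (hO : D.IsEtThOrigin) {M : ℕ+} (μ : D.CyclotomeMod l M)
    {N : ℕ} (hMN : (M : ℕ) = l * N) {σ σ₀ : Pi C} (y : D.H1 D.GtpYdd)
    (hy : haveI := D.compat.GtpYdd_normal
      ContH1.conj D.toTheta D.DeltaTheta (σ : D.PiTemp) E.etaDd =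
        ContH1.conj D.toTheta D.DeltaTheta (σ₀ : D.PiTemp) E.etaDd * y ^ (M : ℕ))
    (g : ↥(PiYdd C ⊓ ⊤)) (hg : (g : Pi C) ∈ chiKer C M) :
    haveI := piYdd_normal C D.compat
    ((ContH1.conjCocycle (phi C) (D.lDeltaTheta l) σ₀ (rootLiftCocycle C)).1 g)⁻¹ *
        (ContH1.conjCocycle (phi C) (D.lDeltaTheta l) σ (rootLiftCocycle C)).1 g ∈
      (powMonoidHom N : D.lDeltaTheta l →* D.lDeltaTheta l).range :=
  conj_rootLift_div_mem_range_pow C D.compat hO μ hMN y hy g hg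

end EtaleThetaDataOfSetting

/-! ## [IUTchII] Prop. 2.1, well-definedness of the top row at the [EtTh] model -/

namespace BadPlaceSetting

open Literature.AnabelianGeometry.EtaleTheta

variable {p : ℕ} [Fact p.Prime] {D : Literature.AnabelianGeometry.EtaleTheta.ThetaSetting p}
  {E : D.EtaleThetaData} {l : ℕ} (C : E.DoubleUnderline l) {N : ℕ+} (μ : D.CyclotomeMod l N)
  (hS : D.Sec2Hyps) (hl : l.Prime) (hp2 : p ≠ 2) (hpl : p ≠ l)
  (hζ : ∃ ζ : D.K, IsPrimitiveRoot ζ (4 * l))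
  {η : (C.thetaEnvData μ D.compat hS).PiYdd → MuN p N} (hη : η ∈ (C.thetaEnvData μ D.compat hS).thetaCocycles)

/-- K-move, node `IUTchII:Prop2.1`, site `TemperedCoverings.YL_eq_of_cor218_i`/`hC` (F-2491 supplied): for the
bad-place setting of the Tate curve, any two Prop. 2.1 outputs over the same topological group have the same top row,
granted the named fact `Cor218_i` for the rigidity data — the [EtTh] §1 containments no longer a binder.
[claim: Mochizuki2012, status: disputed] (IUTchII §2 Prop 2.1, kurims p.65) -/
theorem _root_.Literature.IUT.HodgeArakelov.TemperedCoverings.YL_eq_of_cor218_i_compatSupplied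
    (h15 : D.Prop15iii E D.compat) (L : C.CuspLabels) (R : RigidData.{0} N l)
    (hR : R = C.rigidData μ D.compat hS h15 L) (h218i : R.Cor218_i)
    {P : TopGroup.{0}} (T₁ T₂ : TemperedCoverings (ofDoubleUnderline C μ D.compat hS hl hp2 hpl hζ hη) P) :
    T₁.YL = T₂.YL ∧ T₁.YddL = T₂.YddL :=
  TemperedCoverings.YL_eq_of_cor218_i C μ D.compat hS hl hp2 hpl hζ hη h15 L R hR h218i T₁ T₂

/-- K-move, node `IUTchII:Prop2.1`, site `TemperedCoverings.YL_eq_of_piYddCharacteristic`/`hC` (F-2491 supplied):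
the same, modulo (H1) `PiYddCharacteristic C` — the [EtTh] §1 containments no longer a binder.
[claim: Mochizuki2012, status: disputed] (IUTchII §2 Prop 2.1, kurims p.65) -/
theorem _root_.Literature.IUT.HodgeArakelov.TemperedCoverings.YL_eq_of_piYddCharacteristic_compatSupplied
    (hH1 : EtaleThetaDataOfSetting.PiYddCharacteristic C) {P : TopGroup.{0}}
    (T₁ T₂ : TemperedCoverings (ofDoubleUnderline C μ D.compat hS hl hp2 hpl hζ hη) P) :
    T₁.YL = T₂.YL ∧ T₁.YddL = T₂.YddL :=
  TemperedCoverings.YL_eq_of_piYddCharacteristic C μ D.compat hS hl hp2 hpl hζ hη hH1 T₁ T₂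

end BadPlaceSetting

/-! ## [IUTchII] Prop. 2.2 (i)′ at the model `Π_v := Π^tp_X̲̲` -/

section Prop22

open Literature.AnabelianGeometry.EtaleTheta (ContH1)
open EtaleThetaDataOfSetting

variable {p : ℕ} [Fact p.Prime] {D : Literature.AnabelianGeometry.EtaleTheta.ThetaSetting p}
  {E : D.EtaleThetaData} {l : ℕ} (C : E.DoubleUnderline l)

/-- K-move, node `IUTchII:Prop2.2(i)`, site `prop22_i'_etaleThetaDataOfSetting`/`hC` (F-2491 supplied): the repaired
Prop. 2.2 (i)′ holds for the Prop. 1.4 output `etaleThetaDataOfSetting' C D.compat hS hchar S eS hl` given the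
anabelian input `R.GroupTheoretic` and `hsurj` — the [EtTh] §1 containments (hence the normality input
`piYdd_normal`) no longer a binder. [claim: Mochizuki2012, status: disputed] (IUTchII §2 Prop 2.2 (i), kurims pp.66-67) -/
theorem prop22_i'_etaleThetaDataOfSetting_compatSupplied (hS : D.Sec2Hyps) (hchar : PiYddCharacteristic C)
    (S : BadPlaceSetting.{0}) (eS : (Pi C) ≃ₜ* S.PiX) (hl : S.l = l)
    (R : SubgraphReference S) (T : TemperedCoverings S (Pi C)) {G : EnvOfGroup S.toThetaSetting (Pi C)}
    (ι₀ : PointedInversion G (etaleThetaDataOfSetting' C D.compat hS hchar S.toThetaSetting eS hl))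
    (hG : R.GroupTheoretic)
    (hsurj : ∃ e₀ : (Pi C) ≃ₜ* S.PiX, ∀ x : Pi C, ∃ b : Pi C, e₀ b ∈ R.refBullet ∧
      G.recon.projG (G.isoX b) = G.recon.projG (G.isoX x)) :
    Prop22_i' R T (etaleThetaDataOfSetting' C D.compat hS hchar S.toThetaSetting eS hl) ι₀ :=
  prop22_i'_etaleThetaDataOfSetting C D.compat hS hchar S eS hl R T ι₀ hG hsurj

end Prop22

end Literature.IUT.HodgeArakelov
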